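import Summits.KontsevichZagierPeriods.KontsevichZagierPeriods.Theorems.RootDecompWalshStrataConicSection01

/-!
# Root decomposition & Walsh strata — conic-wall SECTIONS, part 2: `InBaker.psection_conic` (gen 8, §37)

Route `RootDecompWalshStrata`, leaf `QuadricBakerDescent` (stmt-27597), residual R-E2 (NODE.md, decomp-kz-lens-4).
A boundary section `(S, ζ)` of an E-type sector piece (`c < 0`) lying on an adapted conic wall
`a(κ₀X² + κ₁Y²) + c = (l₀ + l₁X + l₂Y)²` with `k = aκ₀ − l₁² ≠ 0` and non-zero radicand `δ` is in the
Baker class: split the section by the sign of `E = kX − l₁L(Y)` at its wall point (`E² = δ(Y)`), send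
each signed part through the height reparametrisation `InBaker.psection_height` over the semialgebraic
height set of part 1 (branch `X_ε`, `ε = sgn E`; injectivity of the slope from `height_inj_of_norm`) into
the `R₄`-free conic-wall terminal `InBaker.conic_height_cneg`, and discard the part `E = 0` — finitely
many slopes (the roots of `δ`), a null set.  [KontsevichZagier2001 §1.2 rules (2), (3); BCR1998 §2.2; this node]
-/

noncomputable section

open Set MeasureTheory Literature.NumberTheory.Transcendental
open Literature.ModelTheory.ExponentialFields (IsSemialgebraic IsSemialgebraic)

namespace Summit.KontsevichZagierPeriods.RootDecompWalshStrata.ConicDescent.BallCube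

/-! #### 37.3 Section coordinates -/

/-- The `X`-coordinate `ζ/N(t)` of the wall point over the slope `t = x 0` with `κ`-norm `ζ x`. -/
def secX (κ₀ κ₁ : ℚ) (ζ : (Fin 1 → ℝ) → ℝ) (x : Fin 1 → ℝ) : ℝ := ζ x / pN κ₀ κ₁ (x 0)

/-- The branch discriminator `E = kX − l₁L(Y)` at the wall point over `x` (`E² = δ(Y)`). -/
def secE (W : ConicWall) (ζ : (Fin 1 → ℝ) → ℝ) (x : Fin 1 → ℝ) : ℝ :=
  W.k * secX W.κ₀ W.κ₁ ζ x - W.l₁ * W.L (secX W.κ₀ W.κ₁ ζ x * x 0)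

/-- Auxiliary step `norm_secX`. [bookkeeping] -/
theorem norm_secX {κ₀ κ₁ : ℚ} (hκ : 0 < κ₀ ∧ 0 ≤ κ₁) (ζ : (Fin 1 → ℝ) → ℝ) (x : Fin 1 → ℝ) :
    (κ₀ : ℝ) * secX κ₀ κ₁ ζ x ^ 2 + κ₁ * (secX κ₀ κ₁ ζ x * x 0) ^ 2 = ζ x ^ 2 := by
  have hN := pN_pos hκ (x 0)
  have h1 : secX κ₀ κ₁ ζ x * pN κ₀ κ₁ (x 0) = ζ x := by rw [secX]; field_simp
  rw [show (κ₀ : ℝ) * secX κ₀ κ₁ ζ x ^ 2 + κ₁ * (secX κ₀ κ₁ ζ x * x 0) ^ 2 =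
    secX κ₀ κ₁ ζ x ^ 2 * (κ₀ + κ₁ * x 0 ^ 2) by ring, ← pN_sq hκ, ← mul_pow, h1]

/-- Auxiliary step `isSemialgebraicFunOn_secX`. [bookkeeping] -/
theorem isSemialgebraicFunOn_secX {κ₀ κ₁ : ℚ} (hκ : 0 < κ₀ ∧ 0 ≤ κ₁) {D : Set (Fin 1 → ℝ)}
    (hD : IsSemialgebraic ℚ D) {ζ : (Fin 1 → ℝ) → ℝ} (hζ : IsSemialgebraicFunOn ℚ D ζ) :
    IsSemialgebraicFunOn ℚ D (secX κ₀ κ₁ ζ) := by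
  have hN : IsSemialgebraicFunOn ℚ D fun x => pN κ₀ κ₁ (x 0) :=
    (IsSemialgebraicFunOn.sqrt_holds (isSemialgebraicFunOn_aeval hD
      (MvPolynomial.C κ₀ + MvPolynomial.C κ₁ * MvPolynomial.X 0 ^ 2 :
        MvPolynomial (Fin 1) ℚ))).congr fun x _ => by simp [pN, pW]
  exact (hζ.div hN fun x _ => (pN_pos hκ (x 0)).ne').congr fun x _ => by simp only [secX]

/-- Auxiliary step `isSemialgebraicFunOn_secE`. [bookkeeping] -/
theorem isSemialgebraicFunOn_secE (W : ConicWall) (hκ : 0 < W.κ₀ ∧ 0 ≤ W.κ₁)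
    {D : Set (Fin 1 → ℝ)} (hD : IsSemialgebraic ℚ D) {ζ : (Fin 1 → ℝ) → ℝ}
    (hζ : IsSemialgebraicFunOn ℚ D ζ) : IsSemialgebraicFunOn ℚ D (secE W ζ) := by
  have hX := isSemialgebraicFunOn_secX hκ hD hζ
  have h0 := isSemialgebraicFunOn_apply hD (0 : Fin 1)
  exact (((isSemialgebraicFunOn_ratCast hD W.k).mul_holds hX).sub_holds
    ((isSemialgebraicFunOn_ratCast hD W.l₁).mul_holds ((isSemialgebraicFunOn_ratCast hD W.l₀).add_holds
      ((isSemialgebraicFunOn_ratCast hD W.l₂).mul_holds (hX.mul_holds h0))))).congr fun x _ => by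
    simp only [Pi.add_apply, Pi.mul_apply, Pi.sub_apply, secE, ConicWall.L]

/-! #### 37.4 One branch -/

/-- **CONIC-WALL SECTION, ONE BRANCH.**  A section `(A, ζ)` whose wall points lie on branch `ε` of the
adapted conic wall (`ε·E = √δ > 0`) is in the Baker class (`k ≠ 0`; `c < 0`, or `κ₁ > 0` with the wall
off the centre and no double-root radicand): height reparametrisation over the height set of part 1 + the
`R₄`-free terminal `InBaker.conic_height_gen`. [this node] -/
theorem InBaker.psection_conic_branch (W : ConicWall) (hκ : 0 < W.κ₀ ∧ 0 ≤ W.κ₁) (γ : ℚ)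
    (ha : W.a ≠ 0)
    (hc : W.c < 0 ∨ (0 < W.κ₁ ∧ W.l₀ ^ 2 ≠ W.c ∧ (W.δe ≠ 0 → W.δg - W.δf ^ 2 / (4 * W.δe) ≠ 0)))
    (hk : W.k ≠ 0) (ε : ℚ) (hε : ε = 1 ∨ ε = -1)
    {A : Set (Fin 1 → ℝ)} (ζ : (Fin 1 → ℝ) → ℝ)
    (hζsa : IsSemialgebraicFunOn ℚ A ζ) (hA01 : ∀ x ∈ A, 0 ≤ x 0 ∧ x 0 ≤ 1)
    (hζ : ∀ x ∈ A, 0 < ζ x ∧ ζ x ^ 2 ≤ 1)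
    (hbr : ∀ x ∈ A, (ε : ℝ) * secE W ζ x = √(W.δ (secX W.κ₀ W.κ₁ ζ x * x 0)))
    (hδA : ∀ x ∈ A, 0 < W.δ (secX W.κ₀ W.κ₁ ζ x * x 0))
    (r₁ : KZ.IntegralRep 1) (hr₁ : r₁.domain = A)
    (hint : EqOn r₁.integrand (fun x => ppot W.κ₀ W.κ₁ γ W.a W.c (Fin.snoc x (ζ x))) A) :
    InBaker (KZ.of r₁) := by
  have hκ0 : (0 : ℝ) < W.κ₀ := by exact_mod_cast hκ.1
  have hκ1 : (0 : ℝ) ≤ W.κ₁ := by exact_mod_cast hκ.2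
  -- a rational bound for the heights
  set hi : ℚ := 1 + 1 / W.κ₀ with hhi
  have hhi1 : (1 : ℝ) ≤ hi := by
    have h' : (0 : ℚ) ≤ 1 / W.κ₀ := one_div_nonneg.mpr hκ.1.le
    have h'' : (1 : ℚ) ≤ hi := by rw [hhi]; linarith
    exact_mod_cast h''
  have hhi2 : (1 : ℝ) ≤ hi * W.κ₀ := by
    have h' : hi * W.κ₀ = W.κ₀ + 1 := by
      rw [hhi, add_mul, one_mul, one_div_mul_cancel hκ.1.ne']
    have h'' : (1 : ℚ) ≤ hi * W.κ₀ := by rw [h']; linarith [hκ.1]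
    exact_mod_cast h''
  have hT₀ := W.isSemialgebraic_heightSet ε hi hk ζ hζsa
  refine InBaker.psection_height hκ γ W.a W.c hT₀ (W.Xb ε) (W.Xb' ε)
    (W.isSemialgebraicFunOn_Xb ε hT₀) (W.isSemialgebraicFunOn_Xb' ε hT₀ fun v hv => hv.1.1)
    (fun v hv => hv.1.2.1) (fun v hv => W.hasDerivAt_Xb ε (v 0) hv.1.1.ne')
    (fun u hu v hv huv => ?_) (fun x hx => ?_) ζ (fun v hv _ => hv.2.2) r₁ hr₁ hint
    fun r hrd hri => ?_
  · -- the slope is injective on the height set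
    exact height_inj_of_norm hκ (X := W.Xb ε) (ζ := fun s => ζ fun _ => s) hu.1.2.1 hv.1.2.1
      hu.2.2 hv.2.2 huv
  · -- every section point is reached
    obtain ⟨hz, hz1⟩ := hζ x hx
    obtain ⟨hx0, hx1⟩ := hA01 x hx
    have hN := pN_pos hκ (x 0)
    set Xs := secX W.κ₀ W.κ₁ ζ x with hXs
    set Ys := Xs * x 0 with hYs
    have hXpos : 0 < Xs := div_pos hz hN
    have hXb : W.Xb ε Ys = Xs := W.Xb_of_branch ε hε hk Xs Ys (hbr x hx)
    have hnorm : (W.κ₀ : ℝ) * Xs ^ 2 + W.κ₁ * Ys ^ 2 = ζ x ^ 2 := norm_secX hκ ζ x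
    have hXhi : Xs ≤ hi := by
      have h1 : Xs ^ 2 * W.κ₀ ≤ 1 := by nlinarith [mul_nonneg hκ1 (sq_nonneg Ys)]
      by_contra hcon
      rw [not_le] at hcon
      have h2 : (hi : ℝ) * (hi * W.κ₀) ≤ Xs * (hi * W.κ₀) :=
        mul_le_mul_of_nonneg_right hcon.le (by positivity)
      have h3 : (hi : ℝ) * (Xs * W.κ₀) < Xs * (Xs * W.κ₀) :=
        mul_lt_mul_of_pos_right hcon (mul_pos hXpos hκ0)
      nlinarith
    have hx' : lift₁ (fun s => s / W.Xb ε s) (fun _ => Ys) = x := by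
      funext j
      have hj := Fin.eq_zero j
      subst hj
      rw [lift₁_apply, hXb, hYs]
      field_simp
    refine ⟨fun _ => Ys, ⟨⟨hδA x hx, by rw [hXb]; exact hXpos, mul_nonneg hXpos.le hx0, ?_⟩,
      by rw [hx']; exact hx, ?_⟩, ?_⟩
    · calc Ys = Xs * x 0 := rfl
        _ ≤ Xs * 1 := by gcongr
        _ ≤ hi := by rw [mul_one]; exact hXhi
    · rw [hx', hXb, hnorm, Real.sqrt_sq hz.le]
    · show Ys / W.Xb ε Ys = x 0
      rw [hXb, hYs]
      field_simp
  · -- the height integral: the conic-wall terminal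
    refine InBaker.conic_height_gen W γ ε hε hk ha hκ hc 0 hi r (fun v hv => ?_) (fun v hv => ?_)
      fun v _ => by rw [hri]
    · rw [hrd] at hv
      refine ⟨?_, hv.1.1.2.2.2⟩
      push_cast
      exact hv.1.1.2.2.1
    · rw [hrd] at hv
      exact hv.1.1.1

/-! #### 37.5 The section theorem -/

/-- **CONIC-WALL SECTION.**  A boundary section `(S, ζ)` (`ζ > 0`, `ζ² ≤ 1`, slopes in `[0, 1]`) whose
wall points `(ζ/N(t), tζ/N(t))` lie on the adapted conic wall `a(κ₀X² + κ₁Y²) + c = (l₀ + l₁X + l₂Y)²`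
(`k ≠ 0`, radicand `δ ≢ 0`; `c < 0` or the sign-free alternative of §37.0) is in the Baker class: split by
the sign of `E = kX − l₁L(Y)` into
the two branches (`InBaker.psection_conic_branch`) and the null set `E = 0` (finitely many slopes —
the roots of `δ`). [KontsevichZagier2001 §1.2; this node] -/
theorem InBaker.psection_conic (W : ConicWall) (hκ : 0 < W.κ₀ ∧ 0 ≤ W.κ₁) (γ : ℚ) (ha : W.a ≠ 0)
    (hc : W.c < 0 ∨ (0 < W.κ₁ ∧ W.l₀ ^ 2 ≠ W.c ∧ (W.δe ≠ 0 → W.δg - W.δf ^ 2 / (4 * W.δe) ≠ 0)))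
    (hk : W.k ≠ 0) (hnd : W.δe ≠ 0 ∨ W.δf ≠ 0 ∨ W.δg ≠ 0)
    {S : Set (Fin 1 → ℝ)} (ζ : (Fin 1 → ℝ) → ℝ)
    (hζsa : IsSemialgebraicFunOn ℚ S ζ) (hS01 : ∀ x ∈ S, 0 ≤ x 0 ∧ x 0 ≤ 1)
    (hζ : ∀ x ∈ S, 0 < ζ x ∧ ζ x ^ 2 ≤ 1)
    (hwall : ∀ x ∈ S, (W.a : ℝ) * ζ x ^ 2 + W.c =
      (W.l₀ + (W.l₁ + W.l₂ * x 0) * (ζ x / pN W.κ₀ W.κ₁ (x 0))) ^ 2)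
    (r₁ : KZ.IntegralRep 1) (hr₁ : r₁.domain ⊆ S)
    (hint : EqOn r₁.integrand (fun x => ppot W.κ₀ W.κ₁ γ W.a W.c (Fin.snoc x (ζ x))) r₁.domain) :
    InBaker (KZ.of r₁) := by
  have hk' : (W.k : ℝ) ≠ 0 := by exact_mod_cast hk
  have hD := r₁.isSemialgebraic_domain
  have hζD : IsSemialgebraicFunOn ℚ r₁.domain ζ := hζsa.mono hr₁ hD
  have hE := isSemialgebraicFunOn_secE W hκ hD hζD
  -- `E² = δ(Y)` along the wall
  have hsq : ∀ x ∈ r₁.domain, secE W ζ x ^ 2 = W.δ (secX W.κ₀ W.κ₁ ζ x * x 0) := fun x hx => by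
    refine W.sq_of_wall (secX W.κ₀ W.κ₁ ζ x) (secX W.κ₀ W.κ₁ ζ x * x 0) ?_
    rw [norm_secX hκ ζ x, hwall x (hr₁ hx), secX]
    ring
  -- the pieces
  have hz0 : IsSemialgebraicFunOn ℚ r₁.domain fun _ => (0 : ℝ) :=
    (isSemialgebraicFunOn_ratCast hD 0).congr fun _ _ => by simp
  set A : Set (Fin 1 → ℝ) := {x | x ∈ r₁.domain ∧ 0 < secE W ζ x} with hA_def
  set B : Set (Fin 1 → ℝ) := {x | x ∈ r₁.domain ∧ 0 ≤ (fun x => -secE W ζ x) x} with hB_def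
  have hA : IsSemialgebraic ℚ A := IsSemialgebraicFunOn.isSemialgebraic_sep_pos hE
  have hB : IsSemialgebraic ℚ B := IsSemialgebraicFunOn.isSemialgebraic_sep_nonneg hE.neg
  have hAr : A ⊆ r₁.domain := fun x hx => hx.1
  have hBr : B ⊆ r₁.domain := fun x hx => hx.1
  -- the branch pieces
  have hbranch : ∀ (ε : ℚ), (ε = 1 ∨ ε = -1) → ∀ (P : Set (Fin 1 → ℝ)) (hP : IsSemialgebraic ℚ P)
      (hPr : P ⊆ r₁.domain), (∀ x ∈ P, 0 < (ε : ℝ) * secE W ζ x) →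
      InBaker (KZ.of (r₁.restrict P hP hPr)) := by
    intro ε hε P hP hPr hsgn
    have hε1 : |(ε : ℝ)| = 1 := by rcases hε with rfl | rfl <;> simp
    refine InBaker.psection_conic_branch W hκ γ ha hc hk ε hε ζ (hζD.mono hPr hP)
      (fun x hx => hS01 x (hr₁ (hPr hx))) (fun x hx => hζ x (hr₁ (hPr hx))) (fun x hx => ?_)
      (fun x hx => ?_) _ rfl fun x hx => hint (hPr hx)
    · rw [← hsq x (hPr hx), Real.sqrt_sq_eq_abs, ← abs_of_pos (hsgn x hx), abs_mul, hε1, one_mul]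
    · rw [← hsq x (hPr hx)]
      have h := hsgn x hx
      have hE0 : secE W ζ x ≠ 0 := fun h0 => by rw [h0, mul_zero] at h; exact lt_irrefl _ h
      positivity
  refine InBaker.of_split r₁ hA hB hAr hBr ?_ ?_
    (hbranch 1 (Or.inl rfl) A hA hAr fun x hx => by simpa using hx.2) ?_
  · ext x
    simp only [hA_def, hB_def, mem_union, mem_setOf_eq]
    constructor
    · intro hx
      rcases lt_or_ge 0 (secE W ζ x) with h | h
      · exact Or.inl ⟨hx, h⟩
      · exact Or.inr ⟨hx, by linarith⟩
    · rintro (⟨hx, _⟩ | ⟨hx, _⟩) <;> exact hx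
  · have : A ∩ B = ∅ := by
      ext x
      simp only [hA_def, hB_def, mem_inter_iff, mem_setOf_eq, mem_empty_iff_false, iff_false]
      rintro ⟨⟨_, h1⟩, _, h2⟩
      linarith
    rw [this, measure_empty]
  · -- `B = A₋ ∪ Z`
    set rB := r₁.restrict B hB hBr with hrB
    have hEB : IsSemialgebraicFunOn ℚ B (secE W ζ) := hE.mono hBr hB
    set Am : Set (Fin 1 → ℝ) := {x | x ∈ B ∧ 0 < (fun x => -secE W ζ x) x} with hAm_def
    set Z : Set (Fin 1 → ℝ) := {x | x ∈ B ∧ secE W ζ x = (fun _ => (0 : ℝ)) x} with hZ_def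
    have hAm : IsSemialgebraic ℚ Am := IsSemialgebraicFunOn.isSemialgebraic_sep_pos hEB.neg
    have hZ : IsSemialgebraic ℚ Z := isSemialgebraic_sep_eq hEB (hz0.mono hBr hB)
    have hAmB : Am ⊆ rB.domain := fun x hx => hx.1
    have hZB : Z ⊆ rB.domain := fun x hx => hx.1
    -- `Z` is finite: the height is injective on it and lands in the roots of `δ`
    have hZfin : Z.Finite := by
      refine Set.Finite.of_finite_image ((W.finite_δ_roots hnd).subset ?_)
        (f := fun x => secX W.κ₀ W.κ₁ ζ x * x 0) fun x hx x' hx' hxx' => ?_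
      · rintro _ ⟨x, hx, rfl⟩
        have h0 : secE W ζ x = 0 := hx.2
        simp only [mem_setOf_eq, ← hsq x hx.1.1, h0]
        ring
      · have hN := pN_pos hκ (x 0)
        have hN' := pN_pos hκ (x' 0)
        have hX : 0 < secX W.κ₀ W.κ₁ ζ x := div_pos (hζ x (hr₁ hx.1.1)).1 hN
        have hX' : 0 < secX W.κ₀ W.κ₁ ζ x' := div_pos (hζ x' (hr₁ hx'.1.1)).1 hN'
        have h0 : secE W ζ x = 0 := hx.2
        have h0' : secE W ζ x' = 0 := hx'.2
        simp only [secE] at h0 h0'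
        have hYY : secX W.κ₀ W.κ₁ ζ x * x 0 = secX W.κ₀ W.κ₁ ζ x' * x' 0 := hxx'
        have hXX : secX W.κ₀ W.κ₁ ζ x = secX W.κ₀ W.κ₁ ζ x' := by
          have e1 : secX W.κ₀ W.κ₁ ζ x = W.l₁ * W.L (secX W.κ₀ W.κ₁ ζ x * x 0) / W.k := by
            field_simp; linarith
          have e2 : secX W.κ₀ W.κ₁ ζ x' = W.l₁ * W.L (secX W.κ₀ W.κ₁ ζ x' * x' 0) / W.k := by
            field_simp; linarith
          rw [e1, e2, hYY]
        funext j
        have hj := Fin.eq_zero j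
        subst hj
        rw [hXX] at hYY
        exact mul_left_cancel₀ hX'.ne' hYY
    refine InBaker.of_split rB hAm hZ hAmB hZB ?_ ?_
      (hbranch (-1) (Or.inr rfl) Am hAm (fun x hx => hBr hx.1) fun x hx => by
        have h : 0 < -secE W ζ x := hx.2
        push_cast
        linarith) ?_
    · ext x
      simp only [hAm_def, hZ_def, hrB, KZ.IntegralRep.domain_restrict, mem_union, mem_setOf_eq]
      constructor
      · intro hx
        have hx' : x ∈ B := hx
        rcases lt_or_eq_of_le hx'.2 with h | h
        · exact Or.inl ⟨hx', h⟩
        · exact Or.inr ⟨hx', by simp only at h; linarith⟩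
      · rintro (⟨hx, _⟩ | ⟨hx, _⟩) <;> exact hx
    · exact measure_mono_null inter_subset_right (hZfin.measure_zero _)
    · exact InBaker.of_mem_relations
        (KZ.of_mem_relations_of_volume_eq_zero _ (hZfin.measure_zero _))

end Summit.KontsevichZagierPeriods.RootDecompWalshStrata.ConicDescent.BallCube

end
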